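import Literature.AlgebraicGeometry.Motives.MixedHodgeExtensionBiproductMatrix
import Literature.AlgebraicGeometry.Motives.MixedHodgeExtensionTateTwistModels
import Literature.AlgebraicGeometry.Motives.MixedHodgeStructureJacobianProd
import HarnessLib

/-!
# The biproduct decompositions of `Ext` commute with Tate twists

Cattani–El Zein–Griffiths–Lê, *Hodge Theory*, Ex. 3.2.23: (2) direct sums of mixed Hodge structures are
taken componentwise on `W` and `F`; (4) the twist `H(m)` shifts `W` and `F`. Hence
**`(H₁ ⊕ H₂)(n) = H₁(n) ⊕ H₂(n)`** as mixed Hodge structures on `V × W` (the tree's `prod_tateTwist`),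
the structure maps of the biproduct twist to the structure maps of the twisted biproduct (§1), and, since
`Ext(∗, ∗)` is an additive bifunctor (Mac Lane III Thm. 2.1; Carlson Prop. 1) on which the twist acts by
`[E] ↦ [E(n)]` (`Ext.tateTwistEquiv`, natural by `MixedHodgeExtensionTateTwistModels`), Mac Lane's
decompositions `Ext(A₁ ⊕ A₂, B) ≅ Ext(A₁, B) × Ext(A₂, B)`, `Ext(A, B₁ ⊕ B₂) ≅ Ext(A, B₁) × Ext(A, B₂)`, the
direct sum of classes `x₁ ⊕ x₂` and the `2 × 2`-matrix decomposition of `Ext(A₁ ⊕ A₂, B₁ ⊕ B₂)` all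
commute with the twist, the identification `(A₁ ⊕ A₂)(n) = A₁(n) ⊕ A₂(n)` being transported by
`Ext.congrLeft` on the quotient side and by push-out along `Hom.ofEq` on the sub side:

* §1 `Hom.ofEq ∘ ι_i(n)`-identities: `ι_i(n)`, `π_i(n)` versus `ι_i`, `π_i` of the twisted summands.
* §2 `Ext(A₁ ⊕ A₂, B)`: `ι_i^* (x(n)) = (ι_i^* x)(n)`, `prodEquivLeft (x(n)) = (x₁(n), x₂(n))`, and the
  inverse (`π_i^*`, Baer sums).
* §3 `Ext(A, B₁ ⊕ B₂)`: `π_j_* (x(n)) = (π_j_* x)(n)`, `prodEquivRight (x(n)) = (y₁(n), y₂(n))`.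
* §4 `(x₁ ⊕ x₂)(n) = x₁(n) ⊕ x₂(n)` (`transport_tateTwistEquiv_prodW`), on extensions
  `[(E₁ ⊕ E₂)(n)] = [E₁(n) ⊕ E₂(n)]`, and the matrix of `x(n)` is the matrix of `x` twisted entrywise
  (`prodEquivFour_transport_tateTwistEquiv`).
* §5 the same on Brylinski–Zucker's `J⁰W₀Hom` (`JHomW.prodEquivLeft/Right` versus `JHomW.tateTwistMap`).

All statements proved; no definitions, no named facts.

## References

* [CattaniElZeinGriffithsLe2014] E. Cattani et al. (eds.), Hodge Theory (2014), Ch. 3 Ex. 3.2.23 (2), (4),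
  p. 163.
* [MacLane1963Homology] S. Mac Lane, Homology (1963), Ch. III Thm. 2.1 and the isomorphisms after it
  (p. 72); (2.3); Lemma 1.6.
* [Carlson1980] J. A. Carlson, Extensions of mixed Hodge structures (1980), §2(b) Prop. 1.
* [BrylinskiZucker1998] J.-L. Brylinski, S. Zucker, An overview of recent advances in Hodge theory,
  Prop. 5.22.
-/

open scoped TensorProduct

noncomputable section

namespace Literature.AlgebraicGeometry.Motives

namespace MixedHodgeStructure

universe u₁ u₂ v₁ v₂ u v w w'

variable {V₁ : Type u₁} [AddCommGroup V₁] [Module ℚ V₁] {V₂ : Type u₂} [AddCommGroup V₂] [Module ℚ V₂]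

/-! ### §1 The structure maps of `(H₁ ⊕ H₂)(n) = H₁(n) ⊕ H₂(n)` -/

section Homs

variable (H₁ : MixedHodgeStructure V₁) (H₂ : MixedHodgeStructure V₂) (n : ℤ)

/-- `Hom.ofEq ∘ ι₁ = ι₁(n)`: the injection of `H₁(n)` into `H₁(n) ⊕ H₂(n) = (H₁ ⊕ H₂)(n)` is the twist
of `ι₁`. [cite: CattaniElZeinGriffithsLe2014, Ex. 3.2.23 (4), p. 163] -/
theorem Hom.ofEq_comp_inl_tateTwist :
    (Hom.ofEq (prod_tateTwist H₁ H₂ n).symm).comp (Hom.inl (H₁.tateTwist n) (H₂.tateTwist n)) =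
      (Hom.inl H₁ H₂).tateTwist n :=
  Hom.ext (LinearMap.id_comp _)

/-- `Hom.ofEq ∘ ι₂ = ι₂(n)`. [cite: CattaniElZeinGriffithsLe2014, Ex. 3.2.23 (4), p. 163] -/
theorem Hom.ofEq_comp_inr_tateTwist :
    (Hom.ofEq (prod_tateTwist H₁ H₂ n).symm).comp (Hom.inr (H₁.tateTwist n) (H₂.tateTwist n)) =
      (Hom.inr H₁ H₂).tateTwist n :=
  Hom.ext (LinearMap.id_comp _)

/-- `π₁ ∘ Hom.ofEq = π₁(n)`. [cite: CattaniElZeinGriffithsLe2014, Ex. 3.2.23 (4), p. 163] -/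
theorem Hom.fst_tateTwist_comp_ofEq :
    (Hom.fst (H₁.tateTwist n) (H₂.tateTwist n)).comp (Hom.ofEq (prod_tateTwist H₁ H₂ n)) =
      (Hom.fst H₁ H₂).tateTwist n :=
  Hom.ext (LinearMap.comp_id _)

/-- `π₂ ∘ Hom.ofEq = π₂(n)`. [cite: CattaniElZeinGriffithsLe2014, Ex. 3.2.23 (4), p. 163] -/
theorem Hom.snd_tateTwist_comp_ofEq :
    (Hom.snd (H₁.tateTwist n) (H₂.tateTwist n)).comp (Hom.ofEq (prod_tateTwist H₁ H₂ n)) =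
      (Hom.snd H₁ H₂).tateTwist n :=
  Hom.ext (LinearMap.comp_id _)

/-- `Hom.ofEq ∘ ι₁(n) = ι₁` (the other direction). [cite: CattaniElZeinGriffithsLe2014, Ex. 3.2.23 (4), p. 163] -/
theorem Hom.ofEq_comp_inl_tateTwist' :
    (Hom.ofEq (prod_tateTwist H₁ H₂ n)).comp ((Hom.inl H₁ H₂).tateTwist n) =
      Hom.inl (H₁.tateTwist n) (H₂.tateTwist n) :=
  Hom.ext (LinearMap.id_comp _)

/-- `Hom.ofEq ∘ ι₂(n) = ι₂`. [cite: CattaniElZeinGriffithsLe2014, Ex. 3.2.23 (4), p. 163] -/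
theorem Hom.ofEq_comp_inr_tateTwist' :
    (Hom.ofEq (prod_tateTwist H₁ H₂ n)).comp ((Hom.inr H₁ H₂).tateTwist n) =
      Hom.inr (H₁.tateTwist n) (H₂.tateTwist n) :=
  Hom.ext (LinearMap.id_comp _)

/-- `π₁(n) ∘ Hom.ofEq = π₁`. [cite: CattaniElZeinGriffithsLe2014, Ex. 3.2.23 (4), p. 163] -/
theorem Hom.fst_tateTwist_comp_ofEq' :
    ((Hom.fst H₁ H₂).tateTwist n).comp (Hom.ofEq (prod_tateTwist H₁ H₂ n).symm) =
      Hom.fst (H₁.tateTwist n) (H₂.tateTwist n) :=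
  Hom.ext (LinearMap.comp_id _)

/-- `π₂(n) ∘ Hom.ofEq = π₂`. [cite: CattaniElZeinGriffithsLe2014, Ex. 3.2.23 (4), p. 163] -/
theorem Hom.snd_tateTwist_comp_ofEq' :
    ((Hom.snd H₁ H₂).tateTwist n).comp (Hom.ofEq (prod_tateTwist H₁ H₂ n).symm) =
      Hom.snd (H₁.tateTwist n) (H₂.tateTwist n) :=
  Hom.ext (LinearMap.comp_id _)

end Homs

variable {W₁ : Type v₁} [AddCommGroup W₁] [Module ℚ W₁] {W₂ : Type v₂} [AddCommGroup W₂] [Module ℚ W₂]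
variable {VA : Type u} [AddCommGroup VA] [Module ℚ VA] {VB : Type v} [AddCommGroup VB] [Module ℚ VB]

namespace Ext

/-! ### §2 `Ext(A₁ ⊕ A₂, B)`: the decomposition commutes with the twist -/

section Left

variable {A₁ : MixedHodgeStructure V₁} {A₂ : MixedHodgeStructure V₂} {B : MixedHodgeStructure VB} (n : ℤ)

/-- `congrLeft` is additive (it is a pull-back). [cite: Carlson1980, §2(b) Prop. 1] -/
theorem congrLeft_addW {A A' : MixedHodgeStructure VA} {B : MixedHodgeStructure VB} (h : A = A')
    (x y : Ext A B) : congrLeft h (addW x y) = addW (congrLeft h x) (congrLeft h y) := by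
  rw [congrLeft_eq_pullbackMapW, congrLeft_eq_pullbackMapW, congrLeft_eq_pullbackMapW, pullbackMapW_addW]

/-- **`ι₁^* (x(n)) = (ι₁^* x)(n)`** under `(A₁ ⊕ A₂)(n) = A₁(n) ⊕ A₂(n)`. [cite: MacLane1963Homology, Ch. III Thm. 2.1] -/
theorem pullbackMapW_inl_congrLeft_tateTwistEquiv (x : Ext (A₁.prod A₂) B) :
    pullbackMapW (Hom.inl (A₁.tateTwist n) (A₂.tateTwist n))
        (congrLeft (prod_tateTwist A₁ A₂ n) (tateTwistEquiv n x)) =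
      tateTwistEquiv n (pullbackMapW (Hom.inl A₁ A₂) x) := by
  rw [congrLeft_eq_pullbackMapW, ← pullbackMapW_comp, Hom.ofEq_comp_inl_tateTwist,
    tateTwistEquiv_pullbackMapW]

/-- **`ι₂^* (x(n)) = (ι₂^* x)(n)`.** [cite: MacLane1963Homology, Ch. III Thm. 2.1] -/
theorem pullbackMapW_inr_congrLeft_tateTwistEquiv (x : Ext (A₁.prod A₂) B) :
    pullbackMapW (Hom.inr (A₁.tateTwist n) (A₂.tateTwist n))
        (congrLeft (prod_tateTwist A₁ A₂ n) (tateTwistEquiv n x)) =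
      tateTwistEquiv n (pullbackMapW (Hom.inr A₁ A₂) x) := by
  rw [congrLeft_eq_pullbackMapW, ← pullbackMapW_comp, Hom.ofEq_comp_inr_tateTwist,
    tateTwistEquiv_pullbackMapW]

/-- **`prodEquivLeft (x(n)) = (x₁(n), x₂(n))`**: the decomposition `Ext(A₁ ⊕ A₂, B) ≅ Ext(A₁, B) × Ext(A₂, B)`
commutes with the Tate twist. [cite: MacLane1963Homology, Ch. III Thm. 2.1] -/
theorem prodEquivLeft_congrLeft_tateTwistEquiv (x : Ext (A₁.prod A₂) B) :
    prodEquivLeft (A₁.tateTwist n) (A₂.tateTwist n) (B.tateTwist n)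
        (congrLeft (prod_tateTwist A₁ A₂ n) (tateTwistEquiv n x)) =
      (tateTwistEquiv n (prodEquivLeft A₁ A₂ B x).1, tateTwistEquiv n (prodEquivLeft A₁ A₂ B x).2) := by
  rw [prodEquivLeft_apply, prodEquivLeft_apply, pullbackMapW_inl_congrLeft_tateTwistEquiv,
    pullbackMapW_inr_congrLeft_tateTwistEquiv]

/-- `(π₁^* x₁)(n) = π₁^* (x₁(n))` under `(A₁ ⊕ A₂)(n) = A₁(n) ⊕ A₂(n)`. [cite: MacLane1963Homology, Ch. III Thm. 2.1] -/
theorem congrLeft_tateTwistEquiv_pullbackMapW_fst (x₁ : Ext A₁ B) :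
    congrLeft (prod_tateTwist A₁ A₂ n) (tateTwistEquiv n (pullbackMapW (Hom.fst A₁ A₂) x₁)) =
      pullbackMapW (Hom.fst (A₁.tateTwist n) (A₂.tateTwist n)) (tateTwistEquiv n x₁) := by
  rw [congrLeft_eq_pullbackMapW, tateTwistEquiv_pullbackMapW, ← pullbackMapW_comp,
    Hom.fst_tateTwist_comp_ofEq']

/-- `(π₂^* x₂)(n) = π₂^* (x₂(n))`. [cite: MacLane1963Homology, Ch. III Thm. 2.1] -/
theorem congrLeft_tateTwistEquiv_pullbackMapW_snd (x₂ : Ext A₂ B) :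
    congrLeft (prod_tateTwist A₁ A₂ n) (tateTwistEquiv n (pullbackMapW (Hom.snd A₁ A₂) x₂)) =
      pullbackMapW (Hom.snd (A₁.tateTwist n) (A₂.tateTwist n)) (tateTwistEquiv n x₂) := by
  rw [congrLeft_eq_pullbackMapW, tateTwistEquiv_pullbackMapW, ← pullbackMapW_comp,
    Hom.snd_tateTwist_comp_ofEq']

/-- The inverse decomposition commutes with the twist: `(π₁^* x₁ + π₂^* x₂)(n) = π₁^* x₁(n) + π₂^* x₂(n)`.
[cite: MacLane1963Homology, Ch. III Thm. 2.1] -/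
theorem congrLeft_tateTwistEquiv_prodEquivLeft_symm (p : Ext A₁ B × Ext A₂ B) :
    congrLeft (prod_tateTwist A₁ A₂ n) (tateTwistEquiv n ((prodEquivLeft A₁ A₂ B).symm p)) =
      (prodEquivLeft (A₁.tateTwist n) (A₂.tateTwist n) (B.tateTwist n)).symm
        (tateTwistEquiv n p.1, tateTwistEquiv n p.2) := by
  rw [prodEquivLeft_symm_apply, prodEquivLeft_symm_apply, tateTwistEquiv_addW, congrLeft_addW,
    congrLeft_tateTwistEquiv_pullbackMapW_fst, congrLeft_tateTwistEquiv_pullbackMapW_snd]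

end Left

/-! ### §3 `Ext(A, B₁ ⊕ B₂)`: the decomposition commutes with the twist -/

section Right

variable {A : MixedHodgeStructure VA} {B₁ : MixedHodgeStructure W₁} {B₂ : MixedHodgeStructure W₂} (n : ℤ)

/-- **`π₁_* (x(n)) = (π₁_* x)(n)`** under `(B₁ ⊕ B₂)(n) = B₁(n) ⊕ B₂(n)` (transport by push-out along
`Hom.ofEq`). [cite: MacLane1963Homology, Ch. III Thm. 2.1] -/
theorem pushoutMapW_fst_ofEq_tateTwistEquiv (x : Ext A (B₁.prod B₂)) :
    pushoutMapW (Hom.fst (B₁.tateTwist n) (B₂.tateTwist n))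
        (pushoutMapW (Hom.ofEq (prod_tateTwist B₁ B₂ n)) (tateTwistEquiv n x)) =
      tateTwistEquiv n (pushoutMapW (Hom.fst B₁ B₂) x) := by
  rw [← pushoutMapW_comp, Hom.fst_tateTwist_comp_ofEq, tateTwistEquiv_pushoutMapW]

/-- **`π₂_* (x(n)) = (π₂_* x)(n)`.** [cite: MacLane1963Homology, Ch. III Thm. 2.1] -/
theorem pushoutMapW_snd_ofEq_tateTwistEquiv (x : Ext A (B₁.prod B₂)) :
    pushoutMapW (Hom.snd (B₁.tateTwist n) (B₂.tateTwist n))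
        (pushoutMapW (Hom.ofEq (prod_tateTwist B₁ B₂ n)) (tateTwistEquiv n x)) =
      tateTwistEquiv n (pushoutMapW (Hom.snd B₁ B₂) x) := by
  rw [← pushoutMapW_comp, Hom.snd_tateTwist_comp_ofEq, tateTwistEquiv_pushoutMapW]

/-- **`prodEquivRight (x(n)) = (y₁(n), y₂(n))`**: the decomposition `Ext(A, B₁ ⊕ B₂) ≅ Ext(A, B₁) × Ext(A, B₂)`
commutes with the Tate twist. [cite: MacLane1963Homology, Ch. III Thm. 2.1] -/
theorem prodEquivRight_pushoutMapW_ofEq_tateTwistEquiv (x : Ext A (B₁.prod B₂)) :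
    prodEquivRight (A.tateTwist n) (B₁.tateTwist n) (B₂.tateTwist n)
        (pushoutMapW (Hom.ofEq (prod_tateTwist B₁ B₂ n)) (tateTwistEquiv n x)) =
      (tateTwistEquiv n (prodEquivRight A B₁ B₂ x).1, tateTwistEquiv n (prodEquivRight A B₁ B₂ x).2) := by
  rw [prodEquivRight_apply, prodEquivRight_apply, pushoutMapW_fst_ofEq_tateTwistEquiv,
    pushoutMapW_snd_ofEq_tateTwistEquiv]

/-- `(ι₁_* y₁)(n)` transported is `ι₁_* (y₁(n))`. [cite: MacLane1963Homology, Ch. III Thm. 2.1] -/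
theorem pushoutMapW_ofEq_tateTwistEquiv_pushoutMapW_inl (y₁ : Ext A B₁) :
    pushoutMapW (Hom.ofEq (prod_tateTwist B₁ B₂ n)) (tateTwistEquiv n (pushoutMapW (Hom.inl B₁ B₂) y₁)) =
      pushoutMapW (Hom.inl (B₁.tateTwist n) (B₂.tateTwist n)) (tateTwistEquiv n y₁) := by
  rw [tateTwistEquiv_pushoutMapW, ← pushoutMapW_comp, Hom.ofEq_comp_inl_tateTwist']

/-- `(ι₂_* y₂)(n)` transported is `ι₂_* (y₂(n))`. [cite: MacLane1963Homology, Ch. III Thm. 2.1] -/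
theorem pushoutMapW_ofEq_tateTwistEquiv_pushoutMapW_inr (y₂ : Ext A B₂) :
    pushoutMapW (Hom.ofEq (prod_tateTwist B₁ B₂ n)) (tateTwistEquiv n (pushoutMapW (Hom.inr B₁ B₂) y₂)) =
      pushoutMapW (Hom.inr (B₁.tateTwist n) (B₂.tateTwist n)) (tateTwistEquiv n y₂) := by
  rw [tateTwistEquiv_pushoutMapW, ← pushoutMapW_comp, Hom.ofEq_comp_inr_tateTwist']

/-- The inverse decomposition commutes with the twist: `(ι₁_* y₁ + ι₂_* y₂)(n) = ι₁_* y₁(n) + ι₂_* y₂(n)`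
(after transport). [cite: MacLane1963Homology, Ch. III Thm. 2.1] -/
theorem pushoutMapW_ofEq_tateTwistEquiv_prodEquivRight_symm (p : Ext A B₁ × Ext A B₂) :
    pushoutMapW (Hom.ofEq (prod_tateTwist B₁ B₂ n)) (tateTwistEquiv n ((prodEquivRight A B₁ B₂).symm p)) =
      (prodEquivRight (A.tateTwist n) (B₁.tateTwist n) (B₂.tateTwist n)).symm
        (tateTwistEquiv n p.1, tateTwistEquiv n p.2) := by
  rw [prodEquivRight_symm_apply, prodEquivRight_symm_apply, tateTwistEquiv_addW, pushoutMapW_addW,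
    pushoutMapW_ofEq_tateTwistEquiv_pushoutMapW_inl, pushoutMapW_ofEq_tateTwistEquiv_pushoutMapW_inr]

end Right

/-! ### §4 `(x₁ ⊕ x₂)(n) = x₁(n) ⊕ x₂(n)` and the matrix of `x(n)` -/

section Both

variable {A₁ : MixedHodgeStructure V₁} {A₂ : MixedHodgeStructure V₂} {B₁ : MixedHodgeStructure W₁}
  {B₂ : MixedHodgeStructure W₂} (n : ℤ)

/-- **`(x₁ ⊕ x₂)(n) = x₁(n) ⊕ x₂(n)`**: the twist of a direct sum of classes, transported along
`(A₁ ⊕ A₂)(n) = A₁(n) ⊕ A₂(n)` (`congrLeft`) and `(B₁ ⊕ B₂)(n) = B₁(n) ⊕ B₂(n)` (push-out along `Hom.ofEq`),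
is the direct sum of the twists. [cite: MacLane1963Homology, Ch. III (2.3)] -/
theorem transport_tateTwistEquiv_prodW (x₁ : Ext A₁ B₁) (x₂ : Ext A₂ B₂) :
    pushoutMapW (Hom.ofEq (prod_tateTwist B₁ B₂ n))
        (congrLeft (prod_tateTwist A₁ A₂ n) (tateTwistEquiv n (prodW x₁ x₂))) =
      prodW (tateTwistEquiv n x₁) (tateTwistEquiv n x₂) := by
  rw [congrLeft_eq_pullbackMapW, prodW_def, prodW_def, tateTwistEquiv_addW, pullbackMapW_addW,
    pushoutMapW_addW, tateTwistEquiv_pushoutMapW, tateTwistEquiv_pushoutMapW, tateTwistEquiv_pullbackMapW,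
    tateTwistEquiv_pullbackMapW]
  simp only [← pushoutMapW_pullbackMapW, ← pushoutMapW_comp, ← pullbackMapW_comp,
    Hom.ofEq_comp_inl_tateTwist', Hom.ofEq_comp_inr_tateTwist', Hom.fst_tateTwist_comp_ofEq',
    Hom.snd_tateTwist_comp_ofEq']

variable {VE : Type w} [AddCommGroup VE] [Module ℚ VE] {VE' : Type w'} [AddCommGroup VE'] [Module ℚ VE']

/-- **On extensions: `[(E₁ ⊕ E₂)(n)] = [E₁(n) ⊕ E₂(n)]`** after the two transports.
[cite: MacLane1963Homology, Ch. III (2.3)] -/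
theorem transport_mkOfW_prod_tateTwist (E₁ : Extension A₁ B₁ VE) (E₂ : Extension A₂ B₂ VE') :
    pushoutMapW (Hom.ofEq (prod_tateTwist B₁ B₂ n))
        (congrLeft (prod_tateTwist A₁ A₂ n) (mkOfW ((E₁.prod E₂).tateTwist n))) =
      mkOfW ((E₁.tateTwist n).prod (E₂.tateTwist n)) := by
  rw [← tateTwistEquiv_mkOfW, ← prodW_mkOfW E₁ E₂, transport_tateTwistEquiv_prodW, tateTwistEquiv_mkOfW,
    tateTwistEquiv_mkOfW, prodW_mkOfW]

/-- **The matrix of `x(n)` is the matrix of `x` twisted entrywise**: `π_j_* ι_i^* (x(n)) = (π_j_* ι_i^* x)(n)`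
after the two transports. [cite: MacLane1963Homology, Ch. III Thm. 2.1] -/
theorem prodEquivFour_transport_tateTwistEquiv (x : Ext (A₁.prod A₂) (B₁.prod B₂)) :
    prodEquivFour (A₁.tateTwist n) (A₂.tateTwist n) (B₁.tateTwist n) (B₂.tateTwist n)
        (pushoutMapW (Hom.ofEq (prod_tateTwist B₁ B₂ n))
          (congrLeft (prod_tateTwist A₁ A₂ n) (tateTwistEquiv n x))) =
      ((tateTwistEquiv n (prodEquivFour A₁ A₂ B₁ B₂ x).1.1, tateTwistEquiv n (prodEquivFour A₁ A₂ B₁ B₂ x).1.2),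
        (tateTwistEquiv n (prodEquivFour A₁ A₂ B₁ B₂ x).2.1,
          tateTwistEquiv n (prodEquivFour A₁ A₂ B₁ B₂ x).2.2)) := by
  simp only [prodEquivFour_apply, ← pushoutMapW_pullbackMapW, pullbackMapW_inl_congrLeft_tateTwistEquiv,
    pullbackMapW_inr_congrLeft_tateTwistEquiv, pushoutMapW_fst_ofEq_tateTwistEquiv,
    pushoutMapW_snd_ofEq_tateTwistEquiv]

/-- `x(n)` is a direct sum of classes iff `x` is. [cite: MacLane1963Homology, Ch. III (2.3)] -/
theorem exists_eq_prodW_transport_tateTwistEquiv_iff (x : Ext (A₁.prod A₂) (B₁.prod B₂)) :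
    (∃ (y₁ : Ext (A₁.tateTwist n) (B₁.tateTwist n)) (y₂ : Ext (A₂.tateTwist n) (B₂.tateTwist n)),
        pushoutMapW (Hom.ofEq (prod_tateTwist B₁ B₂ n))
            (congrLeft (prod_tateTwist A₁ A₂ n) (tateTwistEquiv n x)) = prodW y₁ y₂) ↔
      ∃ (x₁ : Ext A₁ B₁) (x₂ : Ext A₂ B₂), x = prodW x₁ x₂ := by
  rw [exists_eq_prodW_iff, exists_eq_prodW_iff, ← pushoutMapW_pullbackMapW, ← pushoutMapW_pullbackMapW,
    pullbackMapW_inl_congrLeft_tateTwistEquiv, pullbackMapW_inr_congrLeft_tateTwistEquiv,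
    pushoutMapW_snd_ofEq_tateTwistEquiv, pushoutMapW_fst_ofEq_tateTwistEquiv, ← tateTwistEquiv_zeroW n,
    (tateTwistEquiv n).injective.eq_iff, ← tateTwistEquiv_zeroW n, (tateTwistEquiv n).injective.eq_iff]

end Both

end Ext

/-! ### §5 The same on `J⁰W₀Hom` -/

namespace JHomW

variable {A₁ : MixedHodgeStructure V₁} {A₂ : MixedHodgeStructure V₂} {B₁ : MixedHodgeStructure W₁}
  {B₂ : MixedHodgeStructure W₂} {A : MixedHodgeStructure VA} {B : MixedHodgeStructure VB} (n : ℤ)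

/-- `f'^* (f^* c) = (f ∘ f')^* c` (pointwise form of `precomp_comp`). [cite: Carlson1980, §2(b) Prop. 1] -/
theorem precomp_precomp {VA' VA'' : Type*} [AddCommGroup VA'] [Module ℚ VA'] [AddCommGroup VA''] [Module ℚ VA'']
    {A' : MixedHodgeStructure VA'} {A'' : MixedHodgeStructure VA''} (f : Hom A' A) (f' : Hom A'' A')
    (c : JHomW A B) : precomp B f' (precomp B f c) = precomp B (f.comp f') c := by
  rw [precomp_comp, LinearMap.comp_apply]

/-- `g'_* (g_* c) = (g' ∘ g)_* c` (pointwise form of `postcomp_comp`). [cite: Carlson1980, §2(b) Prop. 1] -/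
theorem postcomp_postcomp {VB' VB'' : Type*} [AddCommGroup VB'] [Module ℚ VB'] [AddCommGroup VB'']
    [Module ℚ VB''] {B' : MixedHodgeStructure VB'} {B'' : MixedHodgeStructure VB''} (g' : Hom B' B'')
    (g : Hom B B') (c : JHomW A B) : postcomp A g' (postcomp A g c) = postcomp A (g'.comp g) c := by
  rw [postcomp_comp, LinearMap.comp_apply]

/-- **`JHomW.prodEquivLeft` commutes with the twist** (transport by `Hom.ofEq^*`):
`ι_i^* [φ](n) = (ι_i^* [φ])(n)`. [cite: BrylinskiZucker1998, Prop. 5.22] -/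
theorem prodEquivLeft_precomp_ofEq_tateTwistMap (c : JHomW (A₁.prod A₂) B) :
    prodEquivLeft (A₁.tateTwist n) (A₂.tateTwist n) (B.tateTwist n)
        (precomp (B.tateTwist n) (Hom.ofEq (prod_tateTwist A₁ A₂ n).symm) (tateTwistMap n c)) =
      (tateTwistMap n (prodEquivLeft A₁ A₂ B c).1, tateTwistMap n (prodEquivLeft A₁ A₂ B c).2) := by
  rw [prodEquivLeft_apply, prodEquivLeft_apply, precomp_precomp, precomp_precomp,
    Hom.ofEq_comp_inl_tateTwist, Hom.ofEq_comp_inr_tateTwist, tateTwistMap_precomp, tateTwistMap_precomp]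

/-- **`JHomW.prodEquivRight` commutes with the twist** (transport by `Hom.ofEq_*`):
`π_j_* [φ](n) = (π_j_* [φ])(n)`. [cite: BrylinskiZucker1998, Prop. 5.22] -/
theorem prodEquivRight_postcomp_ofEq_tateTwistMap (c : JHomW A (B₁.prod B₂)) :
    prodEquivRight (A.tateTwist n) (B₁.tateTwist n) (B₂.tateTwist n)
        (postcomp (A.tateTwist n) (Hom.ofEq (prod_tateTwist B₁ B₂ n)) (tateTwistMap n c)) =
      (tateTwistMap n (prodEquivRight A B₁ B₂ c).1, tateTwistMap n (prodEquivRight A B₁ B₂ c).2) := by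
  rw [prodEquivRight_apply, prodEquivRight_apply, postcomp_postcomp, postcomp_postcomp,
    Hom.fst_tateTwist_comp_ofEq, Hom.snd_tateTwist_comp_ofEq, tateTwistMap_postcomp, tateTwistMap_postcomp]

end JHomW

end MixedHodgeStructure

end Literature.AlgebraicGeometry.Motives

end
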